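import Summits.QuantumFields.YangMills.Theorems.MirrorModularBoostsHypercubicLimitClosureHalvesDefs
import Summits.QuantumFields.YangMills.Theorems.LangevinControlUVOSLegsAtWeakCouplingCDefs
import Summits.QuantumFields.YangMills.Theorems.LangevinControlUVOSLegsAtWeakCouplingCStubLocalityFlatApprox
import HarnessLib

/-!
# Crux `WeakCouplingHypercubicLimit` (stmt-QuantumFields-16120), line `Sketch`, r10 toolkit: separated density
with support control (sub-goal SG-D `separatedDensity_of_isOffDiagonal`)

Helper file of the lead (c4) for the r10 skeleton `Cruxes/WeakCouplingHypercubicLimit/Lines/Sketch.lean`.  The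
skeleton proves reflection positivity and the mass-gap decay of the continuum limit first for test functions
COMPACTLY supported at pairwise SEPARATED points and then extends by density + continuity; beyond the landed density
theorem `exists_separated_tendsto_of_isOffDiagonal` (`LangevinControlUVOSLegsAtWeakCouplingCStubLocalityFlatApprox`)
it needs two extra invariants of the approximants `u m → F`:

* `tsupport (u m) ⊆ tsupport F` (positive-time support with a margin and time ordering are preserved) — the
  approximants of the landed construction ARE cutoffs of `F` (compact bump cutoff `exists_offDiagonal_cutoff_tendsto'`,
  then pair cutoff `exists_pairCutoff_tendsto`, both with `tsupport ⊆ tsupport` of the input), so the closure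
  argument of the template is simply re-run with the support inclusion added to the target set
  (`exists_separated_tsupport_subset_tendsto`);
* realness is preserved when `F` is real — obtained a posteriori by symmetrisation: if `conj F = F`, replace `u m`
  by `½ (u m + conj (u m))` (`starTest`, the continuous `ℝ`-linear conjugation on `𝓢`), which is real, supported
  inside `support (u m)`, and still converges to `½ (F + conj F) = F`.

Refs: Hörmander, ALPDO I, Lemma 7.1.8; Osterwalder–Schrader 1973 §2 (the spaces `⁰𝒮`).
-/

noncomputable section

open scoped SchwartzMap BigOperators ComplexConjugate
open MeasureTheory Filter Topology
open Literature.MathematicalPhysics.QuantumFieldTheory Literature.MathematicalPhysics.QuantumLattice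
open Literature.MathematicalPhysics.AQFT
open Literature.Probability.LatticeModels (box Site)
open Summit.QuantumFields.YangMills.Cruxes.HypercubicLimit.CouplingResponse
open Summit.QuantumFields.YangMills.Cruxes.OSLegsFromFemtoAndGap.DlrCollarTransfer (plane conn Decay RPPos ConnCS)
open Summit.QuantumFields.YangMills.Cruxes.OSLegsAtWeakCouplingC.Sketch (Separated)
open Summit.QuantumFields.YangMills.Theorems.OSLegsFromFemtoAndGap

namespace Summit.QuantumFields.YangMills.Theorems.WeakCouplingHypercubicLimit.TraceNormColdPressure

-- adapted from `Cruxes.OSLegsAtWeakCouplingC.Sketch.exists_separated_tendsto_of_isOffDiagonal`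
open Summit.QuantumFields.YangMills.Theorems.OSLegsAtWeakCouplingC (exists_pairCutoff_tendsto) in
/-- **Separated density with support control.**  Every `F ∈ ⁰𝒮((ℝ⁴)ⁿ)` is the Schwartz limit of compactly
supported `u m` with `tsupport (u m) ⊆ Separated n δ_m` for some `δ_m > 0` AND `tsupport (u m) ⊆ tsupport F`: the
compact bump cutoffs of `F` stay in `⁰𝒮` and inside `tsupport F` (`exists_offDiagonal_cutoff_tendsto'`), each is
the Schwartz limit of its pair cutoffs, supported inside its support and separated (`exists_pairCutoff_tendsto`),
and a sequence is extracted from the closure (`𝓢` is first countable). -/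
theorem exists_separated_tsupport_subset_tendsto {n : ℕ} (F : 𝓢((Fin n → EuclideanSpace ℝ (Fin 4)), ℂ))
    (hF : IsOffDiagonal F) :
    ∃ u : ℕ → 𝓢((Fin n → EuclideanSpace ℝ (Fin 4)), ℂ),
      (∀ m, HasCompactSupport (u m : (Fin n → EuclideanSpace ℝ (Fin 4)) → ℂ)) ∧
      (∀ m, ∃ δ : ℝ, 0 < δ ∧ tsupport (u m : (Fin n → EuclideanSpace ℝ (Fin 4)) → ℂ) ⊆ Separated n δ) ∧
      (∀ m, tsupport (u m : (Fin n → EuclideanSpace ℝ (Fin 4)) → ℂ) ⊆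
        tsupport (F : (Fin n → EuclideanSpace ℝ (Fin 4)) → ℂ)) ∧
      Tendsto u atTop (𝓝 F) := by
  set A : Set 𝓢((Fin n → EuclideanSpace ℝ (Fin 4)), ℂ) :=
    {u | HasCompactSupport (u : (Fin n → EuclideanSpace ℝ (Fin 4)) → ℂ) ∧
      (∃ δ : ℝ, 0 < δ ∧ tsupport (u : (Fin n → EuclideanSpace ℝ (Fin 4)) → ℂ) ⊆ Separated n δ) ∧
      tsupport (u : (Fin n → EuclideanSpace ℝ (Fin 4)) → ℂ) ⊆
        tsupport (F : (Fin n → EuclideanSpace ℝ (Fin 4)) → ℂ)} with hA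
  suffices hF' : F ∈ closure A by
    obtain ⟨u, huA, hu⟩ := mem_closure_iff_seq_limit.1 hF'
    exact ⟨u, fun m => (huA m).1, fun m => (huA m).2.1, fun m => (huA m).2.2, hu⟩
  obtain ⟨G, hGsupp, hGoff, hGlim⟩ := exists_offDiagonal_cutoff_tendsto' F hF
  refine isClosed_closure.mem_of_tendsto hGlim (Eventually.of_forall fun m => ?_)
  obtain ⟨v, hv, hvlim⟩ := exists_pairCutoff_tendsto (hGoff m) ((hGsupp m).trans Set.inter_subset_right)
  refine mem_closure_of_tendsto hvlim
    (Eventually.of_forall fun j => ⟨?_, ⟨((j : ℝ) + 1)⁻¹, by positivity, ?_⟩, ?_⟩)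
  · exact IsCompact.of_isClosed_subset (isCompact_closedBall _ _) (isClosed_tsupport _)
      ((hv j).trans (Set.inter_subset_left.trans ((hGsupp m).trans Set.inter_subset_right)))
  · intro x hx
    simp only [Separated, Set.mem_setOf_eq, dist_eq_norm]
    exact ((hv j) hx).2
  · exact (hv j).trans (Set.inter_subset_left.trans ((hGsupp m).trans Set.inter_subset_left))

/-- **SG-D: separated density with support control and realness** (variant of
`exists_separated_tendsto_of_isOffDiagonal`).  Every `F ∈ ⁰𝒮((ℝ⁴)ⁿ)` is the Schwartz limit of compactly supported
`u m`, each supported at pairwise distances `≥ δ_m > 0` and inside `tsupport F`, and real-valued whenever `F` is: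
the approximants of `exists_separated_tsupport_subset_tendsto`, symmetrised to `½ (u m + conj (u m))` when
`conj F = F` (conjugation `starTest` is continuous on `𝓢`, so the symmetrised sequence tends to `½ (F + conj F) = F`;
its support lies inside `support (u m)`). -/
theorem separatedDensity_of_isOffDiagonal :
    ∀ (n : ℕ) (F : 𝓢((Fin n → EuclideanSpace ℝ (Fin 4)), ℂ)), IsOffDiagonal F →
      ∃ u : ℕ → 𝓢((Fin n → EuclideanSpace ℝ (Fin 4)), ℂ),
        (∀ m, HasCompactSupport (u m : (Fin n → EuclideanSpace ℝ (Fin 4)) → ℂ)) ∧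
        (∀ m, ∃ δ : ℝ, 0 < δ ∧ tsupport (u m : (Fin n → EuclideanSpace ℝ (Fin 4)) → ℂ) ⊆ Separated n δ) ∧
        (∀ m, tsupport (u m : (Fin n → EuclideanSpace ℝ (Fin 4)) → ℂ) ⊆
          tsupport (F : (Fin n → EuclideanSpace ℝ (Fin 4)) → ℂ)) ∧
        ((∀ x, conj (F x) = F x) → ∀ m x, conj (u m x) = u m x) ∧
        Tendsto u atTop (𝓝 F) := by
  intro n F hF
  obtain ⟨u, hcs, hsep, hsupp, hlim⟩ := exists_separated_tsupport_subset_tendsto F hF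
  by_cases hreal : ∀ x, conj (F x) = F x
  · -- symmetrise: `w m = ½ (u m + conj (u m))`
    set w : ℕ → 𝓢((Fin n → EuclideanSpace ℝ (Fin 4)), ℂ) := fun m => (2⁻¹ : ℂ) • (u m + starTest (u m))
      with hw
    have hw_apply : ∀ m x, w m x = 2⁻¹ * (u m x + conj (u m x)) := fun m x => rfl
    have hwsupp : ∀ m, Function.support (w m : (Fin n → EuclideanSpace ℝ (Fin 4)) → ℂ) ⊆
        Function.support (u m : (Fin n → EuclideanSpace ℝ (Fin 4)) → ℂ) := fun m =>
      Function.support_subset_iff'.2 fun x hx => by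
        rw [Function.mem_support, not_not] at hx
        rw [hw_apply, hx, map_zero, add_zero, mul_zero]
    have hwtsupp : ∀ m, tsupport (w m : (Fin n → EuclideanSpace ℝ (Fin 4)) → ℂ) ⊆
        tsupport (u m : (Fin n → EuclideanSpace ℝ (Fin 4)) → ℂ) := fun m => closure_mono (hwsupp m)
    refine ⟨w, fun m => (hcs m).mono (hwsupp m), fun m => ?_, fun m => (hwtsupp m).trans (hsupp m),
      fun _ m x => ?_, ?_⟩
    · obtain ⟨δ, hδ, hδsupp⟩ := hsep m
      exact ⟨δ, hδ, (hwtsupp m).trans hδsupp⟩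
    · rw [hw_apply, map_mul, map_add, Complex.conj_conj, map_inv₀, map_ofNat, add_comm (conj (u m x))]
    · have hΦ : Continuous fun f : 𝓢((Fin n → EuclideanSpace ℝ (Fin 4)), ℂ) => (2⁻¹ : ℂ) • (f + starTest f) := by
        fun_prop
      have hfix : (2⁻¹ : ℂ) • (F + starTest F) = F := by
        ext x
        change (2⁻¹ : ℂ) • (F x + conj (F x)) = F x
        rw [hreal x, smul_eq_mul]
        ring
      have h := (hΦ.tendsto F).comp hlim
      rw [hfix] at h
      exact h
  · exact ⟨u, hcs, hsep, hsupp, fun h => absurd h hreal, hlim⟩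

end Summit.QuantumFields.YangMills.Theorems.WeakCouplingHypercubicLimit.TraceNormColdPressure

end
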